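import Summits.HodgeConjecture.CorCM.GaloisDegenerateQuadraticExtension
import Summits.HodgeConjecture.CorCM.GaloisDegenerateExtension
import HarnessLib

/-!
# THE MONOTONICITY THEOREM: BAD ascends along every Galois CM extension, GOOD descends to every Galois CM subfield

COR-CM (cell `pub-hodgecm2`), binder seat b04 (gen 32), count-neutral own lane «Galois-CM-type classification».  Packaging of
`CorCM/GaloisDegenerateQuadraticExtension` (degree `2`, gen 32, unconditional) with `CorCM/GaloisDegenerateExtension` (degree `≥ 3`,
gen 31).  KERNEL ONLY: theorems; no definition, no named fact, no `sorry`.  `HC_CM` is neither used nor claimed.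

For Galois CM fields `K ⊋ K₀ ⊇ ℚ` (any degree `[K:K₀] ≥ 2`, no splitting, no size or exponent hypothesis):

* **`exists_simple_degenerate_of_subfield_of_two_le`** — if `K₀` has a PRIMITIVE DEGENERATE CM type then `K` carries a SIMPLE
  DEGENERATE abelian variety of dimension `[K:ℚ]/2` with CM by `K` (a rational `(p,p)` class outside the divisor ring on a power);
  forms `…_of_intermediateField_of_two_le`, `…_of_fixedField_of_ne_bot` (`N ◁ Gal(K/ℚ)`, `N ≠ 1`, complex conjugation `∉ N`).
* **`isNondegenerate_of_isPrimitive_of_subfield_of_two_le`** (+ `…_intermediateField…`, `…_fixedField…`) — GOOD DESCENDS: if every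
  primitive CM type of `K` is nondegenerate (the Hodge ring of every power of every simple abelian variety with CM by `K` is generated
  by divisor classes, so the Hodge conjecture holds for all of them), then the same holds for every Galois CM subfield of `K`.
So the class of BAD Galois CM fields is closed upwards and the class of GOOD ones closed downwards along Galois CM subextensions;
in the seat's `(Gal, c)` tables every quotient `(G/N, c̄)` (`c ∉ N ◁ G`) of a GOOD pair is GOOD, and every pair with a BAD quotient
is BAD — without the case distinctions (index, splitting through `c`, `|G| ≤ 2^(|Q|/8)`, exponent) of gens 30–31.
«BAD»/«GOOD» as in the sequel files: BAD = an exceptional Hodge class on a power of a simple CM abelian variety (its algebraicity is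
the open question; BAD does not refute HC); GOOD = `B = D` on all powers of all simple CM abelian varieties with CM by the field.

## References

* [Kubota1965] T. Kubota, *On the field extension by complex multiplication*, Trans. AMS 118 (1965), §2, §4 Lemma 2.
* [Shimura1998] G. Shimura, *Abelian Varieties with Complex Multiplication and Modular Functions*, §6.2 Thm. 3, §8.2 Prop. 26.
* [Gordon1999HodgeAVSurvey] B. B. Gordon, *A survey of the Hodge conjecture for abelian varieties*, Thm. 6.4, §9.3.
-/

noncomputable section

open CategoryTheory CategoryTheory.Limits NumberField
open scoped BigOperators

namespace Summit.HodgeConjecture.CorCM.GaloisModels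

open Literature.NumberTheory.ComplexMultiplication
open Literature.AlgebraicGeometry.Motives (AbelianVariety CMType)
open Literature.AlgebraicGeometry.HodgeTheory
open Literature.AlgebraicGeometry.ComplexMultiplication (IsCMTypeRealisation)
open Literature.AlgebraicGeometry.Pohlmann1968
open Literature.Barriers.HodgeConjecture (divisorClassesSpan)
open Summit.HodgeConjecture.CorCM.GaloisRank

section Field

variable {K : Type} [Field K] [NumberField K] [IsCMField K] [IsGalois ℚ K]

/-! ## §1 BAD ascends -/

/-- **THE MONOTONICITY THEOREM: BAD ASCENDS ALONG EVERY GALOIS CM EXTENSION.**  `K ⊇ K₀ ⊇ ℚ` Galois CM fields with `K ≠ K₀`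
(`[K:K₀] ≥ 2`); if `K₀` has a PRIMITIVE DEGENERATE CM type then `K` carries a SIMPLE DEGENERATE abelian variety of dimension
`[K:ℚ]/2` with CM by `K`.  Degree `2`: `exists_simple_degenerate_of_subfield_two`; degree `≥ 3`: `CorCM/GaloisDegenerateExtension`.
[cite: Kubota1965, §2 and §4 Lemma 2] [cite: Shimura1998, §6.2 Thm. 3 and §8.2 Prop. 26] [cite: Gordon1999HodgeAVSurvey, Thm. 6.4 and §9.3] -/
theorem exists_simple_degenerate_of_subfield_of_two_le (K₀ : Type) [Field K₀] [NumberField K₀] [IsCMField K₀]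
    [IsGalois ℚ K₀] [Algebra K₀ K] [IsScalarTower ℚ K₀ K] (hdeg : 2 ≤ Module.finrank K₀ K)
    (Φ₀ : CMType K₀) (φ₀ : K₀ →+* ℂ) (hprim : IsPrimitive (ℂ ≃+* ℂ) Φ₀.1 φ₀) (hndg : ¬ IsNondegenerate Φ₀) :
    ∃ (Φ : CMType K) (φ : K →+* ℂ) (X : AbelianVariety ℂ) (ι : 𝓞 K →+* End X)
      (ϑ : K →+* Module.End ℂ (complexBetti X.X 1)),
      IsPrimitive (ℂ ≃+* ℂ) Φ.1 φ ∧ ¬ IsNondegenerate Φ ∧ IsCMTypeRealisation Φ X ι ϑ ∧ X.IsSimple ∧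
      X.dim = Module.finrank ℚ K / 2 ∧
      ∃ m p : ℕ, ∃ y : complexBetti (⨁ fun _ : Fin m => X).X (2 * p), IsRationalClass y ∧
        IsOfHodgeType (⨁ fun _ : Fin m => X).dim (⨁ fun _ : Fin m => X).X (2 * p) p p y ∧
        y ∉ divisorClassesSpan (⨁ fun _ : Fin m => X).X (⨁ fun _ : Fin m => X).dim p := by
  by_cases h2 : Module.finrank K₀ K = 2
  · exact exists_simple_degenerate_of_subfield_two K₀ h2 Φ₀ φ₀ hprim hndg
  · exact exists_simple_degenerate_of_subfield K₀ (by omega) Φ₀ φ₀ hprim hndg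

/-- **… for an intermediate field** `K₀ ≤ K`, Galois CM over `ℚ`, with `[K : K₀] ≥ 2`. [cite: Kubota1965, §2 and §4 Lemma 2]
[cite: Shimura1998, §6.2 Thm. 3 and §8.2 Prop. 26] [cite: Gordon1999HodgeAVSurvey, Thm. 6.4 and §9.3] -/
theorem exists_simple_degenerate_of_intermediateField_of_two_le (K₀ : IntermediateField ℚ K) [IsCMField K₀] [IsGalois ℚ K₀]
    (hdeg : 2 ≤ Module.finrank K₀ K) (Φ₀ : CMType K₀) (φ₀ : K₀ →+* ℂ) (hprim : IsPrimitive (ℂ ≃+* ℂ) Φ₀.1 φ₀)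
    (hndg : ¬ IsNondegenerate Φ₀) :
    ∃ (Φ : CMType K) (φ : K →+* ℂ) (X : AbelianVariety ℂ) (ι : 𝓞 K →+* End X)
      (ϑ : K →+* Module.End ℂ (complexBetti X.X 1)),
      IsPrimitive (ℂ ≃+* ℂ) Φ.1 φ ∧ ¬ IsNondegenerate Φ ∧ IsCMTypeRealisation Φ X ι ϑ ∧ X.IsSimple ∧
      X.dim = Module.finrank ℚ K / 2 ∧
      ∃ m p : ℕ, ∃ y : complexBetti (⨁ fun _ : Fin m => X).X (2 * p), IsRationalClass y ∧
        IsOfHodgeType (⨁ fun _ : Fin m => X).dim (⨁ fun _ : Fin m => X).X (2 * p) p p y ∧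
        y ∉ divisorClassesSpan (⨁ fun _ : Fin m => X).X (⨁ fun _ : Fin m => X).dim p :=
  exists_simple_degenerate_of_subfield_of_two_le K₀ hdeg Φ₀ φ₀ hprim hndg

/-- **… for a fixed field `K^N`**: `N ◁ Gal(K/ℚ)`, `N ≠ 1`, complex conjugation `∉ N`; `K^N` (Galois CM) has a primitive degenerate
CM type ⟹ `K` is BAD. [cite: Kubota1965, §2 and §4 Lemma 2] [cite: Shimura1998, §6.2 Thm. 3 and §8.2 Prop. 26]
[cite: Gordon1999HodgeAVSurvey, Thm. 6.4 and §9.3] -/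
theorem exists_simple_degenerate_of_fixedField_of_ne_bot (N : Subgroup (K ≃ₐ[ℚ] K)) [N.Normal]
    (hc : (IsCMField.complexConj K).restrictScalars ℚ ∉ N) (hN : N ≠ ⊥)
    (Φ₀ : CMType (IntermediateField.fixedField N)) (φ₀ : IntermediateField.fixedField N →+* ℂ)
    (hprim : IsPrimitive (ℂ ≃+* ℂ) Φ₀.1 φ₀) (hndg : ¬ IsNondegenerate Φ₀) :
    ∃ (Φ : CMType K) (φ : K →+* ℂ) (X : AbelianVariety ℂ) (ι : 𝓞 K →+* End X)
      (ϑ : K →+* Module.End ℂ (complexBetti X.X 1)),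
      IsPrimitive (ℂ ≃+* ℂ) Φ.1 φ ∧ ¬ IsNondegenerate Φ ∧ IsCMTypeRealisation Φ X ι ϑ ∧ X.IsSimple ∧
      X.dim = Module.finrank ℚ K / 2 ∧
      ∃ m p : ℕ, ∃ y : complexBetti (⨁ fun _ : Fin m => X).X (2 * p), IsRationalClass y ∧
        IsOfHodgeType (⨁ fun _ : Fin m => X).dim (⨁ fun _ : Fin m => X).X (2 * p) p p y ∧
        y ∉ divisorClassesSpan (⨁ fun _ : Fin m => X).X (⨁ fun _ : Fin m => X).dim p := by
  haveI : IsCMField (IntermediateField.fixedField N) := isCMField_fixedField_of_not_mem N hc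
  haveI : IsGalois ℚ (IntermediateField.fixedField N) := IsGalois.of_fixedField_normal_subgroup N
  refine exists_simple_degenerate_of_subfield_of_two_le (IntermediateField.fixedField N) ?_ Φ₀ φ₀ hprim hndg
  rw [IntermediateField.finrank_fixedField_eq_card]
  have h1 : Nat.card N ≠ 1 := fun h => hN ((Subgroup.eq_bot_iff_card N).2 h)
  have h0 : Nat.card N ≠ 0 := Nat.card_pos.ne'
  omega

/-! ## §2 GOOD descends -/

/-- **GOOD DESCENDS TO EVERY GALOIS CM SUBFIELD.**  If every primitive CM type of the Galois CM field `K` is nondegenerate (the Hodge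
ring of every power of every simple abelian variety with CM by `K` is generated by divisor classes), then so is every primitive CM
type of every Galois CM subfield `K₀` with `[K:K₀] ≥ 2` (and trivially for `K₀ = K`). [cite: Kubota1965, §2 and §4 Lemma 2]
[cite: Shimura1998, §8.2 Prop. 26] -/
theorem isNondegenerate_of_isPrimitive_of_subfield_of_two_le (K₀ : Type) [Field K₀] [NumberField K₀] [IsCMField K₀]
    [IsGalois ℚ K₀] [Algebra K₀ K] [IsScalarTower ℚ K₀ K] (hdeg : 2 ≤ Module.finrank K₀ K)
    (hgood : ∀ (Φ : CMType K) (φ : K →+* ℂ), IsPrimitive (ℂ ≃+* ℂ) Φ.1 φ → IsNondegenerate Φ)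
    (Φ₀ : CMType K₀) (φ₀ : K₀ →+* ℂ) (hprim : IsPrimitive (ℂ ≃+* ℂ) Φ₀.1 φ₀) : IsNondegenerate Φ₀ := by
  by_contra hndg
  obtain ⟨Φ, φ, X, ι, ϑ, H1, H2, -⟩ := exists_simple_degenerate_of_subfield_of_two_le K₀ hdeg Φ₀ φ₀ hprim hndg
  exact H2 (hgood Φ φ H1)

/-- GOOD descends to an intermediate field `K₀ ≤ K`, Galois CM over `ℚ`, `[K:K₀] ≥ 2`. [cite: Kubota1965, §2 and §4 Lemma 2]
[cite: Shimura1998, §8.2 Prop. 26] -/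
theorem isNondegenerate_of_isPrimitive_of_intermediateField_of_two_le (K₀ : IntermediateField ℚ K) [IsCMField K₀]
    [IsGalois ℚ K₀] (hdeg : 2 ≤ Module.finrank K₀ K)
    (hgood : ∀ (Φ : CMType K) (φ : K →+* ℂ), IsPrimitive (ℂ ≃+* ℂ) Φ.1 φ → IsNondegenerate Φ)
    (Φ₀ : CMType K₀) (φ₀ : K₀ →+* ℂ) (hprim : IsPrimitive (ℂ ≃+* ℂ) Φ₀.1 φ₀) : IsNondegenerate Φ₀ :=
  isNondegenerate_of_isPrimitive_of_subfield_of_two_le K₀ hdeg hgood Φ₀ φ₀ hprim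

/-- GOOD descends to the fixed field of every normal subgroup `N ≠ 1` not containing complex conjugation — in `(Gal, c)`-terms:
**every CM quotient `(G/N, c̄)` of a GOOD pair is GOOD.** [cite: Kubota1965, §2 and §4 Lemma 2] [cite: Shimura1998, §8.2 Prop. 26] -/
theorem isNondegenerate_of_isPrimitive_of_fixedField_of_ne_bot (N : Subgroup (K ≃ₐ[ℚ] K)) [N.Normal]
    (hc : (IsCMField.complexConj K).restrictScalars ℚ ∉ N) (hN : N ≠ ⊥)
    (hgood : ∀ (Φ : CMType K) (φ : K →+* ℂ), IsPrimitive (ℂ ≃+* ℂ) Φ.1 φ → IsNondegenerate Φ)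
    (Φ₀ : CMType (IntermediateField.fixedField N)) (φ₀ : IntermediateField.fixedField N →+* ℂ)
    (hprim : IsPrimitive (ℂ ≃+* ℂ) Φ₀.1 φ₀) : IsNondegenerate Φ₀ := by
  by_contra hndg
  obtain ⟨Φ, φ, X, ι, ϑ, H1, H2, -⟩ := exists_simple_degenerate_of_fixedField_of_ne_bot N hc hN Φ₀ φ₀ hprim hndg
  exact H2 (hgood Φ φ H1)

end Field

end Summit.HodgeConjecture.CorCM.GaloisModels

end
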